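/-
Copyright (c) 2026. All rights reserved.
Released under Apache 2.0 license as described in the file LICENSE.
-/
import Literature.AlgebraicGeometry.Pohlmann1968.MultiquadraticCMFieldNearBentTypes
import Literature.AlgebraicGeometry.Pohlmann1968.MultiquadraticCMFieldWalshValuesQuadraticSubfields
import Literature.NumberTheory.ComplexMultiplication.DegenerateCMTypesElementaryAbelianPrimitiveNearBentTypes
import HarnessLib

/-!
# Multiquadratic CM fields of degree `64` carry PRIMITIVE near-bent CM types: simple abelian `32`-folds of rank `17`
# with an exceptional Hodge class, next to the imprimitive near-bent types whose powers all satisfy the Hodge conjecture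

SETTING (tree `MultiquadraticCMFieldNearBentTypes`, `MultiquadraticCMFieldWalshValuesQuadraticSubfields`,
`DegenerateCMTypesElementaryAbelianPrimitiveNearBentTypes`).  `K` a CM field, Galois over `ℚ` with `Gal(K/ℚ)` of
exponent `2` and `[K:ℚ] = 64` (`K = ℚ(√−d, √a₁, …, √a₅)`, `g = 32`), `φ₀` a base embedding, `T_Φ = {s : σ_s ∈ Φ}`,
`Ŝ_Φ(χ) = Σ_{s ∈ T_Φ} χ(s)`; `Φ` is NEAR-BENT when `Ŝ_Φ(χ) = 0` or `Ŝ_Φ(χ)² = 2g = 64` for every odd `χ` —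
intrinsically (tree `nearBent_iff_of_finrank_eq_sixtyFour`): iff its multiplicity `m_τ(Φ) = #{φ ∈ Φ : φ|_F = τ}` over
every imaginary quadratic subfield `F ⊆ K` and every `τ : F → ℂ` is `12`, `16` or `20`; `Stab(Φ) = {γ : Φγ = Φ}` the
twist stabiliser (`= Gal(K/K*)`, `K*` the reflex field).  The tree proved for near-bent `Φ`: `Rank(Φ) = 17`,
`|Stab(Φ)| ∈ {1, 2}`, and THE DICHOTOMY (`hodgeConjectureFor_pow_or_exists_exceptional`): `|Stab(Φ)| = 2` ⟹ the
abelian varieties of type `(K; Φ)` are not simple and ALL their powers satisfy the Hodge conjecture; `|Stab(Φ)| = 1` ⟹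
they are SIMPLE `32`-folds carrying a rational `(m,m)`-class outside `Dᵐ ⊗ ℂ` (an exceptional Hodge class ON the
variety) — and it exhibited the first branch (`exists_nearBent_of_finrank_eq_sixtyFour`), remarking «a primitive one
would give simple `32`-folds with exceptional Hodge classes».  The group-level existence of primitive near-bent types in
order `64` is g45-#5 (`exists_nearBent_stabilizer_eq_singleton_of_card_eq_sixtyFour`: the concatenation `f₁ ‖ f₂` of
two bent functions of `4` variables that are not translates of each other, C. Carlet [Carlet2020] §7.1.9 II (7.11) and
item 4; `896 = |𝓑₄| > 64`, N. Tokareva [Tokareva2015BentFunctions] §7.1).  THIS FILE is the field dress: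

> **Theorem** (`exists_nearBent_natCard_twistStabilizer_eq_one_of_finrank_eq_sixtyFour`).  Every multiquadratic CM
> field of degree `64` has a near-bent CM type `Φ` with **`|Stab(Φ)| = 1`** (`Stab(Φ) = ⊥`: `Φγ ≠ Φ` for all `γ ≠ 1`).
> **Theorem** (`exists_isSimple_exceptional_nearBent_of_finrank_eq_sixtyFour`).  For such `Φ`: `Rank(Φ) = 17`, and
> EVERY abelian variety `A` of type `(K; Φ)` is a **SIMPLE abelian `32`-fold carrying a rational `(m,m)`-class outside
> `Dᵐ(A) ⊗ ℂ`** for some `m` (the reflex bound `2·|Stab|·(Rank − 1) = 32 < 64` is strict; Kubota–Pohlmann–White);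
> such `A` exist (`exists_isSimple_thirtyTwofold_nearBent_exceptional_of_finrank_eq_sixtyFour`, Shimura §6.2 Thm. 3).
> **Theorem** (`exists_forall_ncard_mem_twistStabilizer_eq_bot_of_finrank_eq_sixtyFour`, base-embedding-free).  There
> is a CM type `Φ` of `K`, moved by every non-trivial Galois twist, whose multiplicity over EVERY imaginary quadratic
> subfield is `12`, `16` or `20`; its abelian varieties are simple with an exceptional Hodge class.
> **Theorem** (`exists_and_exists_of_finrank_eq_sixtyFour`).  BOTH branches of the dichotomy are inhabited in degree
> `64`: near-bent types with `|Stab| = 2` (all powers: Hodge conjecture, tree) AND with `|Stab| = 1` (simple, exceptional).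
> **Theorem** (`lt_ncard_nearBent_of_finrank_eq_sixtyFour`).  `K` has MORE THAN `55 552` near-bent CM types.

HONEST SCOPE.  Whether the exceptional Hodge classes on these simple `32`-folds are algebraic — the Hodge conjecture for
them — is OPEN and not addressed; the sources print the Boolean-function facts (Carlet, Tokareva), the reflex/rank
bookkeeping (Shimura §8.4, §32.10; Kubota §4 Lemma 2) and the exceptional-class mechanism (Pohlmann Thm. 1, White §4
Thm. 3, Gordon Thm. 6.4/§9.2); the assembly is the tree's.  THEOREMS ONLY: no definition, no named fact, no instance,
no `sorry`.

## References

* [Carlet2020] C. Carlet, *Boolean Functions for Cryptography and Coding Theory*, CUP (2020), §7.1.9 II, §6.2.4.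
* [Tokareva2015BentFunctions] N. Tokareva, *Bent Functions*, Academic Press (2015), §7.1.
* [Shimura1998] G. Shimura, *Abelian Varieties with Complex Multiplication and Modular Functions*, §6.2 Thm. 3, §8.4
  Example (1), §32.10.
* [Kubota1965] T. Kubota, *On the field extension by complex multiplication*, Trans. AMS 118 (1965), §4 Lemma 2.
* [Pohlmann1968] H. Pohlmann, *Algebraic cycles on abelian varieties of complex multiplication type*, Ann. of Math. 88
  (1968), Thm. 1.
* [White1993SporadicCycles] S. P. White, *Sporadic cycles on CM abelian varieties*, Compositio Math. 88 (1993), §4 Thm. 3.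
* [Gordon1999HodgeAVSurvey] B. B. Gordon, *A survey of the Hodge conjecture for abelian varieties*, Thm. 6.4, §9.2–9.3.
* [Dodson1984] B. Dodson, *The structure of Galois groups of CM-fields*, Trans. AMS 283 (1984), §3.1.1.

## Provenance

Lane `lit-hodgefound` (Track 2, Layer A3/A5 field dress), seat `lit-hodgefound-p10` generation 45, row g45-#6;
neighbours cited by name, nothing restated: `DegenerateCMTypesElementaryAbelianPrimitiveNearBentTypes` (g45-#5:
`exists_nearBent_stabilizer_eq_singleton_of_card_eq_sixtyFour`, `lt_card_filter_nearBent_of_card_eq_sixtyFour`, USED),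
`MultiquadraticCMFieldNearBentTypes` (g43-#5: `isSimple_and_exists_exceptional_of_natCard_twistStabilizer_eq_one`,
`cmTypeRank_eq_seventeen_of_finrank_eq_sixtyFour`, `exists_nearBent_of_finrank_eq_sixtyFour`,
`hodgeConjectureFor_pow_of_natCard_twistStabilizer_eq_two`, USED), `MultiquadraticCMFieldWalshValuesQuadraticSubfields`
(g45-#4: `nearBent_iff_of_finrank_eq_sixtyFour`, USED), `AbelianCMFieldStabilizerCharacterCriterion`
(`natCard_twistStabilizer_eq_card_stabilizer`), `DegenerateCMTypesCyclicCMFieldTwoOddPrimes`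
(`exists_cmType_of_isCMTypeWith`), `DegenerateCMTypesCyclicCMFieldPrimeSquare` (`ncard_cmType_sep_eq`),
`CMAbelianVarietyRealisedHolds` (`exists_isCMTypeRealisation`), `SimpleDegenerateCMAbelianVarietiesCompositeDimension`
(`conjGalElt_ne_one`, `card_gal_eq_finrank`), `NondegenerateCMTypeExistenceAbelianField` (`apply_conjGal_eq`),
`Motives/VarietiesDimensionProofs` (`schemeDim_eq_holds`).
-/

open scoped BigOperators NumberField IsMulCommutative Classical
open NumberField Module CategoryTheory CategoryTheory.Limits IntermediateField

namespace Literature.AlgebraicGeometry.Pohlmann1968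

namespace MultiquadraticPrimitiveNearBent

open scoped Literature.NumberTheory.ComplexMultiplication
open Literature.NumberTheory.ComplexMultiplication (twistStabilizer IsCMTypeWith conjGal)
open Literature.NumberTheory.ComplexMultiplication.CyclicCMType.ExponentTwo.PrimitiveNearBentTypes
  (exists_nearBent_stabilizer_eq_singleton_of_card_eq_sixtyFour lt_card_filter_nearBent_of_card_eq_sixtyFour)
open Literature.AlgebraicGeometry.Pohlmann1968.MultiquadraticNearBent
  (isSimple_and_exists_exceptional_of_natCard_twistStabilizer_eq_one cmTypeRank_eq_seventeen_of_finrank_eq_sixtyFour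
  exists_nearBent_of_finrank_eq_sixtyFour hodgeConjectureFor_pow_of_natCard_twistStabilizer_eq_two
  two_mul_natCard_twistStabilizer_mul_lt)
open Literature.AlgebraicGeometry.Pohlmann1968.MultiquadraticWalshQuadratic (nearBent_iff_of_finrank_eq_sixtyFour)
open Literature.AlgebraicGeometry.Pohlmann1968.CyclicTwoOddPrimes (exists_cmType_of_isCMTypeWith)
open Literature.AlgebraicGeometry.Motives (CMType AbelianVariety)
open Literature.AlgebraicGeometry.HodgeTheory
open Literature.Barriers.HodgeConjecture (divisorClassesSpan)
open Literature.AlgebraicGeometry.ComplexMultiplication (IsCMTypeRealisation exists_isCMTypeRealisation)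

variable {K : Type} [Field K] [NumberField K] [IsCMField K] [IsGalois ℚ K]

/-! ## §0 Dictionary helpers -/

section Helpers

omit [IsGalois ℚ K] in
/-- `σ_{ρg} = σ̄_g` under the base embedding. [cite: Shimura1998, §18.2 Lemma (i)] -/
private theorem apply_conjGal_eq_pf (φ₀ : K →+* ℂ) (x : K) :
    φ₀ ((conjGal : K ≃ₐ[ℚ] K) x) = starRingEnd ℂ (φ₀ x) :=
  AbelianCMFieldExistence.apply_conjGal_eq φ₀ x

omit [IsGalois ℚ K] in
/-- `ρ ≠ 1`. [cite: Shimura1998, §18.2 Lemma (i)] -/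
private theorem conjGal_ne_one_pf (φ₀ : K →+* ℂ) : (conjGal : K ≃ₐ[ℚ] K) ≠ 1 :=
  conjGalElt_ne_one (apply_conjGal_eq_pf φ₀)

omit [IsCMField K] in
/-- `|Stab(Φ)| = |Stab(T_Φ)|` (abelian `K`). [cite: Shimura1998, §8.4 Example (1)] [cite: Kubota1965, §4 Lemma 2] -/
private theorem natCard_eq_pf (hexp : ∀ g : K ≃ₐ[ℚ] K, g ^ 2 = 1) (φ₀ : K →+* ℂ) (Φ : CMType K) :
    Nat.card (twistStabilizer Φ) =
      (Finset.univ.filter fun g : K ≃ₐ[ℚ] K => ∀ t : K ≃ₐ[ℚ] K,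
        t * g ∈ (Finset.univ.filter fun s : K ≃ₐ[ℚ] K => embOf φ₀ s ∈ Φ.1) ↔
          t ∈ (Finset.univ.filter fun s : K ≃ₐ[ℚ] K => embOf φ₀ s ∈ Φ.1)).card := by
  haveI := Multiquadratic.isAbelianGalois_of_forall_sq_eq_one hexp
  exact natCard_twistStabilizer_eq_card_stabilizer φ₀ Φ

/-- Transport of a count of CM types with a condition on `T_Φ` to `Gal(K/ℚ)` (tree `ncard_cmType_sep_eq`).
[cite: Shimura1998, §8.1] -/
private theorem ncard_eq_card_filter_pf (hexp : ∀ g : K ≃ₐ[ℚ] K, g ^ 2 = 1) (φ₀ : K →+* ℂ)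
    (Q : Finset (K ≃ₐ[ℚ] K) → Prop) :
    {Φ : CMType K | Q (Finset.univ.filter fun s : K ≃ₐ[ℚ] K => embOf φ₀ s ∈ Φ.1)}.ncard =
      ((Finset.univ : Finset (Finset (K ≃ₐ[ℚ] K))).filter fun T : Finset (K ≃ₐ[ℚ] K) =>
        IsCMTypeWith (conjGal : K ≃ₐ[ℚ] K) (T : Set (K ≃ₐ[ℚ] K)) ∧ Q T).card := by
  haveI := Multiquadratic.isAbelianGalois_of_forall_sq_eq_one hexp
  rw [CyclicPrimeSquare.ncard_cmType_sep_eq (apply_conjGal_eq_pf φ₀) _ Q (fun Φ => Iff.rfl)]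
  have hset : {ΦG : Finset (K ≃ₐ[ℚ] K) | IsCMTypeWith (conjGal : K ≃ₐ[ℚ] K) (ΦG : Set (K ≃ₐ[ℚ] K)) ∧ Q ΦG} =
      ↑((Finset.univ : Finset (Finset (K ≃ₐ[ℚ] K))).filter fun T : Finset (K ≃ₐ[ℚ] K) =>
        IsCMTypeWith (conjGal : K ≃ₐ[ℚ] K) (T : Set (K ≃ₐ[ℚ] K)) ∧ Q T) := by
    ext T
    simp only [Set.mem_setOf_eq, Finset.coe_filter, Finset.mem_univ, true_and]
  rw [hset, Set.ncard_coe_finset]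

omit [IsCMField K] [IsGalois ℚ K] in
/-- `CMType K` is finite. [folklore] -/
private theorem finite_cmType_pf : Finite (CMType K) := by
  unfold CMType
  infer_instance

end Helpers

/-! ## §1 Primitive near-bent CM types of a multiquadratic CM field of degree `64` -/

section Existence

/-- **EVERY MULTIQUADRATIC CM FIELD OF DEGREE `64` HAS A NEAR-BENT CM TYPE WITH TRIVIAL STABILISER** (`|Stab(Φ)| = 1`,
equivalently `Stab(Φ) = ⊥`): the group-level primitive near-bent type `f₁ ‖ f₂` of g45-#5 realised by a CM type of `K`.
[cite: Carlet2020, §7.1.9 II and §6.2.4] [cite: Tokareva2015BentFunctions, §7.1] [cite: Shimura1998, §8.4 Example (1)] -/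
theorem exists_nearBent_natCard_twistStabilizer_eq_one_of_finrank_eq_sixtyFour (hexp : ∀ g : K ≃ₐ[ℚ] K, g ^ 2 = 1)
    (φ₀ : K →+* ℂ) (hK : finrank ℚ K = 64) :
    ∃ Φ : CMType K,
      (∀ χ : AddChar (Additive (K ≃ₐ[ℚ] K)) ℂ, χ (Additive.ofMul (conjGal : K ≃ₐ[ℚ] K)) = -1 →
        ∑ s ∈ (Finset.univ.filter fun s : K ≃ₐ[ℚ] K => embOf φ₀ s ∈ Φ.1), χ (Additive.ofMul s) = 0 ∨
          (∑ s ∈ (Finset.univ.filter fun s : K ≃ₐ[ℚ] K => embOf φ₀ s ∈ Φ.1), χ (Additive.ofMul s)) ^ 2 =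
            2 * ((Finset.univ.filter fun s : K ≃ₐ[ℚ] K => embOf φ₀ s ∈ Φ.1).card : ℂ)) ∧
      Nat.card (twistStabilizer Φ) = 1 ∧ twistStabilizer Φ = ⊥ := by
  haveI := Multiquadratic.isAbelianGalois_of_forall_sq_eq_one hexp
  have hcard : Fintype.card (K ≃ₐ[ℚ] K) = 64 := by rw [card_gal_eq_finrank φ₀, hK]
  obtain ⟨T, hT, hnb, hstab⟩ :=
    exists_nearBent_stabilizer_eq_singleton_of_card_eq_sixtyFour hexp (conjGal_ne_one_pf φ₀) hcard
  obtain ⟨Φ, hΦ⟩ := exists_cmType_of_isCMTypeWith (apply_conjGal_eq_pf φ₀) hT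
  have h1 : Nat.card (twistStabilizer Φ) = 1 := by
    rw [natCard_eq_pf hexp φ₀ Φ, hΦ, hstab, Finset.card_singleton]
  refine ⟨Φ, ?_, h1, Subgroup.card_eq_one.1 h1⟩
  rw [hΦ]
  exact hnb

/-- **THE PRIMITIVE NEAR-BENT TYPES OF DEGREE `64`: SIMPLE `32`-FOLDS OF RANK `17` WITH AN EXCEPTIONAL HODGE CLASS.**
`K` has a near-bent CM type `Φ` with `|Stab(Φ)| = 1` and `Rank(Φ) = 17` (the reflex bound `2·|Stab(Φ)|·(Rank − 1) <
[K:ℚ]` strict), and EVERY abelian variety `A` of type `(K; Φ)` is SIMPLE of dimension `32` and carries, for some `m`,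
a rational `(m,m)`-class outside `Dᵐ(A) ⊗ ℂ`.  The Hodge conjecture for these `A` is not decided here.
[cite: Pohlmann1968, Thm. 1] [cite: White1993SporadicCycles, §4 Theorem 3] [cite: Gordon1999HodgeAVSurvey, Thm. 6.4 and §9.2]
[cite: Kubota1965, §4 Lemma 2] [cite: Shimura1998, §32.10] -/
theorem exists_isSimple_exceptional_nearBent_of_finrank_eq_sixtyFour (hexp : ∀ g : K ≃ₐ[ℚ] K, g ^ 2 = 1)
    (φ₀ : K →+* ℂ) (hK : finrank ℚ K = 64) :
    ∃ Φ : CMType K,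
      (∀ χ : AddChar (Additive (K ≃ₐ[ℚ] K)) ℂ, χ (Additive.ofMul (conjGal : K ≃ₐ[ℚ] K)) = -1 →
        ∑ s ∈ (Finset.univ.filter fun s : K ≃ₐ[ℚ] K => embOf φ₀ s ∈ Φ.1), χ (Additive.ofMul s) = 0 ∨
          (∑ s ∈ (Finset.univ.filter fun s : K ≃ₐ[ℚ] K => embOf φ₀ s ∈ Φ.1), χ (Additive.ofMul s)) ^ 2 =
            2 * ((Finset.univ.filter fun s : K ≃ₐ[ℚ] K => embOf φ₀ s ∈ Φ.1).card : ℂ)) ∧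
      Nat.card (twistStabilizer Φ) = 1 ∧ cmTypeRank Φ = 17 ∧
      2 * Nat.card (twistStabilizer Φ) * (cmTypeRank Φ - 1) < finrank ℚ K ∧
      ∀ (A : AbelianVariety ℂ) (ι : 𝓞 K →+* End A) (θ : K →+* Module.End ℂ (complexBetti A.X 1)),
        IsCMTypeRealisation Φ A ι θ →
          A.IsSimple ∧ A.dim = 32 ∧
            ∃ m : ℕ, ∃ c : complexBetti A.X (2 * m), IsRationalClass c ∧
              IsOfHodgeType (finrank ℚ K / 2) A.X (2 * m) m m c ∧ c ∉ divisorClassesSpan A.X (finrank ℚ K / 2) m := by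
  obtain ⟨Φ, hnb, h1, -⟩ := exists_nearBent_natCard_twistStabilizer_eq_one_of_finrank_eq_sixtyFour hexp φ₀ hK
  refine ⟨Φ, hnb, h1, cmTypeRank_eq_seventeen_of_finrank_eq_sixtyFour hexp φ₀ Φ hK hnb,
    two_mul_natCard_twistStabilizer_mul_lt hexp φ₀ Φ hnb h1, fun A ι θ hA => ?_⟩
  obtain ⟨hS, -, hexc⟩ := isSimple_and_exists_exceptional_of_natCard_twistStabilizer_eq_one hexp φ₀ Φ hnb h1 hA
  have hdim : A.dim = finrank ℚ K / 2 := Literature.AlgebraicGeometry.Motives.schemeDim_eq_holds hA.1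
  refine ⟨hS, by rw [hdim, hK], hexc⟩

/-- **UNCONDITIONAL EXISTENCE OF THE VARIETIES** (Shimura §6.2 Thm. 3, tree `exists_isCMTypeRealisation`): over every
multiquadratic CM field of degree `64` there IS a SIMPLE abelian `32`-fold `A` of a near-bent CM type `(K; Φ)` of rank
`17` carrying a rational `(m,m)`-class outside `Dᵐ(A) ⊗ ℂ`. [cite: Shimura1998, §6.2 Thm. 3]
[cite: Gordon1999HodgeAVSurvey, Thm. 6.4 and §9.2] [cite: Pohlmann1968, Thm. 1] -/
theorem exists_isSimple_thirtyTwofold_nearBent_exceptional_of_finrank_eq_sixtyFour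
    (hexp : ∀ g : K ≃ₐ[ℚ] K, g ^ 2 = 1) (φ₀ : K →+* ℂ) (hK : finrank ℚ K = 64) :
    ∃ (Φ : CMType K) (A : AbelianVariety ℂ) (ι : 𝓞 K →+* End A) (θ : K →+* Module.End ℂ (complexBetti A.X 1)),
      IsCMTypeRealisation Φ A ι θ ∧
      (∀ χ : AddChar (Additive (K ≃ₐ[ℚ] K)) ℂ, χ (Additive.ofMul (conjGal : K ≃ₐ[ℚ] K)) = -1 →
        ∑ s ∈ (Finset.univ.filter fun s : K ≃ₐ[ℚ] K => embOf φ₀ s ∈ Φ.1), χ (Additive.ofMul s) = 0 ∨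
          (∑ s ∈ (Finset.univ.filter fun s : K ≃ₐ[ℚ] K => embOf φ₀ s ∈ Φ.1), χ (Additive.ofMul s)) ^ 2 =
            2 * ((Finset.univ.filter fun s : K ≃ₐ[ℚ] K => embOf φ₀ s ∈ Φ.1).card : ℂ)) ∧
      Nat.card (twistStabilizer Φ) = 1 ∧ cmTypeRank Φ = 17 ∧ A.IsSimple ∧ A.dim = 32 ∧
        ∃ m : ℕ, ∃ c : complexBetti A.X (2 * m), IsRationalClass c ∧
          IsOfHodgeType (finrank ℚ K / 2) A.X (2 * m) m m c ∧ c ∉ divisorClassesSpan A.X (finrank ℚ K / 2) m := by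
  obtain ⟨Φ, hnb, h1, hr, -, hall⟩ := exists_isSimple_exceptional_nearBent_of_finrank_eq_sixtyFour hexp φ₀ hK
  obtain ⟨A, ι, θ, hA⟩ := exists_isCMTypeRealisation Φ
  obtain ⟨hS, hd, hexc⟩ := hall A ι θ hA
  exact ⟨Φ, A, ι, θ, hA, hnb, h1, hr, hS, hd, hexc⟩

/-- **BASE-EMBEDDING-FREE FORM.**  A multiquadratic CM field `K` of degree `64` has a CM type `Φ`, MOVED BY EVERY
NON-TRIVIAL GALOIS TWIST (`Stab(Φ) = ⊥`), WHOSE MULTIPLICITY OVER EVERY IMAGINARY QUADRATIC SUBFIELD `F ⊆ K` AND EVERY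
`τ : F → ℂ` IS `12`, `16` OR `20` (the near-bent weights `(12,20), (16,16), (20,12)`, tree
`nearBent_iff_of_finrank_eq_sixtyFour`); every abelian variety of type `(K; Φ)` is simple with an exceptional Hodge
class. [cite: Dodson1984, §3.1.1 Theorem] [cite: Carlet2020, §6.2.4 and §7.1.9 II] [cite: Shimura1998, §8.4 Example (1)]
[cite: Gordon1999HodgeAVSurvey, Thm. 6.4 and §9.2] -/
theorem exists_forall_ncard_mem_twistStabilizer_eq_bot_of_finrank_eq_sixtyFour (hexp : ∀ g : K ≃ₐ[ℚ] K, g ^ 2 = 1)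
    (hK : finrank ℚ K = 64) :
    ∃ Φ : CMType K, twistStabilizer Φ = ⊥ ∧
      (∀ F : IntermediateField ℚ K, finrank ℚ F = 2 → ¬ IsTotallyReal F → ∀ τ : F →+* ℂ,
        {φ : K →+* ℂ | φ.comp (algebraMap F K) = τ ∧ φ ∈ Φ.1}.ncard = 12 ∨
          {φ : K →+* ℂ | φ.comp (algebraMap F K) = τ ∧ φ ∈ Φ.1}.ncard = 16 ∨
          {φ : K →+* ℂ | φ.comp (algebraMap F K) = τ ∧ φ ∈ Φ.1}.ncard = 20) ∧
      ∀ (A : AbelianVariety ℂ) (ι : 𝓞 K →+* End A) (θ : K →+* Module.End ℂ (complexBetti A.X 1)),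
        IsCMTypeRealisation Φ A ι θ →
          A.IsSimple ∧
            ∃ m : ℕ, ∃ c : complexBetti A.X (2 * m), IsRationalClass c ∧
              IsOfHodgeType (finrank ℚ K / 2) A.X (2 * m) m m c ∧ c ∉ divisorClassesSpan A.X (finrank ℚ K / 2) m := by
  obtain ⟨φ₀⟩ := (inferInstance : Nonempty (K →+* ℂ))
  obtain ⟨Φ, hnb, h1, hbot⟩ := exists_nearBent_natCard_twistStabilizer_eq_one_of_finrank_eq_sixtyFour hexp φ₀ hK
  refine ⟨Φ, hbot, (nearBent_iff_of_finrank_eq_sixtyFour hexp φ₀ Φ hK).1 hnb, fun A ι θ hA => ?_⟩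
  obtain ⟨hS, -, hexc⟩ := isSimple_and_exists_exceptional_of_natCard_twistStabilizer_eq_one hexp φ₀ Φ hnb h1 hA
  exact ⟨hS, hexc⟩

/-- **BOTH BRANCHES OF THE NEAR-BENT DICHOTOMY ARE INHABITED IN DEGREE `64`**: there are near-bent CM types with
`|Stab(Φ)| = 2` — every power of every abelian variety of such a type satisfies the Hodge conjecture (tree) — AND
near-bent CM types with `|Stab(Φ)| = 1` — their abelian varieties are simple with an exceptional Hodge class.
[cite: Gordon1999HodgeAVSurvey, Thm. 6.4, §9.2–9.3] [cite: Carlet2020, §7.1.9 II and §6.2.4] [cite: Kubota1965, §4 Lemma 2] -/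
theorem exists_and_exists_of_finrank_eq_sixtyFour (hexp : ∀ g : K ≃ₐ[ℚ] K, g ^ 2 = 1) (φ₀ : K →+* ℂ)
    (hK : finrank ℚ K = 64) :
    (∃ Φ : CMType K,
      (∀ χ : AddChar (Additive (K ≃ₐ[ℚ] K)) ℂ, χ (Additive.ofMul (conjGal : K ≃ₐ[ℚ] K)) = -1 →
        ∑ s ∈ (Finset.univ.filter fun s : K ≃ₐ[ℚ] K => embOf φ₀ s ∈ Φ.1), χ (Additive.ofMul s) = 0 ∨
          (∑ s ∈ (Finset.univ.filter fun s : K ≃ₐ[ℚ] K => embOf φ₀ s ∈ Φ.1), χ (Additive.ofMul s)) ^ 2 =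
            2 * ((Finset.univ.filter fun s : K ≃ₐ[ℚ] K => embOf φ₀ s ∈ Φ.1).card : ℂ)) ∧
      Nat.card (twistStabilizer Φ) = 2 ∧
      ∀ (A : AbelianVariety ℂ) (ι : 𝓞 K →+* End A) (θ : K →+* Module.End ℂ (complexBetti A.X 1)),
        IsCMTypeRealisation Φ A ι θ →
          ∀ n : ℕ, HodgeConjectureFor (⨁ fun _ : Fin n => A).dim (⨁ fun _ : Fin n => A).X) ∧
    (∃ Φ : CMType K,
      (∀ χ : AddChar (Additive (K ≃ₐ[ℚ] K)) ℂ, χ (Additive.ofMul (conjGal : K ≃ₐ[ℚ] K)) = -1 →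
        ∑ s ∈ (Finset.univ.filter fun s : K ≃ₐ[ℚ] K => embOf φ₀ s ∈ Φ.1), χ (Additive.ofMul s) = 0 ∨
          (∑ s ∈ (Finset.univ.filter fun s : K ≃ₐ[ℚ] K => embOf φ₀ s ∈ Φ.1), χ (Additive.ofMul s)) ^ 2 =
            2 * ((Finset.univ.filter fun s : K ≃ₐ[ℚ] K => embOf φ₀ s ∈ Φ.1).card : ℂ)) ∧
      Nat.card (twistStabilizer Φ) = 1 ∧
      ∀ (A : AbelianVariety ℂ) (ι : 𝓞 K →+* End A) (θ : K →+* Module.End ℂ (complexBetti A.X 1)),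
        IsCMTypeRealisation Φ A ι θ →
          A.IsSimple ∧
            ∃ m : ℕ, ∃ c : complexBetti A.X (2 * m), IsRationalClass c ∧
              IsOfHodgeType (finrank ℚ K / 2) A.X (2 * m) m m c ∧
              c ∉ divisorClassesSpan A.X (finrank ℚ K / 2) m) := by
  constructor
  · obtain ⟨Φ, hnb, h2⟩ :=
      MultiquadraticNearBent.exists_nearBent_natCard_twistStabilizer_eq_two hexp φ₀ (k := 2) (by rw [hK]; norm_num)
    exact ⟨Φ, hnb, h2, fun A ι θ hA n => hodgeConjectureFor_pow_of_natCard_twistStabilizer_eq_two hexp φ₀ Φ hnb h2 hA n⟩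
  · obtain ⟨Φ, hnb, h1, -⟩ := exists_nearBent_natCard_twistStabilizer_eq_one_of_finrank_eq_sixtyFour hexp φ₀ hK
    refine ⟨Φ, hnb, h1, fun A ι θ hA => ?_⟩
    obtain ⟨hS, -, hexc⟩ := isSimple_and_exists_exceptional_of_natCard_twistStabilizer_eq_one hexp φ₀ Φ hnb h1 hA
    exact ⟨hS, hexc⟩

end Existence

/-! ## §2 The count: more than `55 552` near-bent CM types -/

section Count

/-- **A MULTIQUADRATIC CM FIELD OF DEGREE `64` HAS MORE THAN `55 552` NEAR-BENT CM TYPES** (the `62 · 896` imprimitive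
ones and at least one primitive one; group level g45-#5). [cite: Tokareva2015BentFunctions, §7.1]
[cite: Carlet2020, §6.2.4 and §7.1.9 II] -/
theorem lt_ncard_nearBent_of_finrank_eq_sixtyFour (hexp : ∀ g : K ≃ₐ[ℚ] K, g ^ 2 = 1) (φ₀ : K →+* ℂ)
    (hK : finrank ℚ K = 64) :
    55552 < {Φ : CMType K |
      ∀ χ : AddChar (Additive (K ≃ₐ[ℚ] K)) ℂ, χ (Additive.ofMul (conjGal : K ≃ₐ[ℚ] K)) = -1 →
        ∑ s ∈ (Finset.univ.filter fun s : K ≃ₐ[ℚ] K => embOf φ₀ s ∈ Φ.1), χ (Additive.ofMul s) = 0 ∨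
          (∑ s ∈ (Finset.univ.filter fun s : K ≃ₐ[ℚ] K => embOf φ₀ s ∈ Φ.1), χ (Additive.ofMul s)) ^ 2 =
            2 * ((Finset.univ.filter fun s : K ≃ₐ[ℚ] K => embOf φ₀ s ∈ Φ.1).card : ℂ)}.ncard := by
  haveI := Multiquadratic.isAbelianGalois_of_forall_sq_eq_one hexp
  have hcard : Fintype.card (K ≃ₐ[ℚ] K) = 64 := by rw [card_gal_eq_finrank φ₀, hK]
  rw [ncard_eq_card_filter_pf hexp φ₀ (fun T : Finset (K ≃ₐ[ℚ] K) =>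
    ∀ χ : AddChar (Additive (K ≃ₐ[ℚ] K)) ℂ, χ (Additive.ofMul (conjGal : K ≃ₐ[ℚ] K)) = -1 →
      ∑ s ∈ T, χ (Additive.ofMul s) = 0 ∨ (∑ s ∈ T, χ (Additive.ofMul s)) ^ 2 = 2 * (T.card : ℂ))]
  convert lt_card_filter_nearBent_of_card_eq_sixtyFour hexp (conjGal_ne_one_pf φ₀) hcard using 3

/-- **… AND A NEAR-BENT CM TYPE WITH TRIVIAL STABILISER: `#{Φ near-bent : |Stab(Φ)| = 1} > 0`.**
[cite: Carlet2020, §7.1.9 II and §6.2.4] [cite: Shimura1998, §8.4 Example (1)] -/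
theorem ncard_nearBent_natCard_twistStabilizer_eq_one_pos (hexp : ∀ g : K ≃ₐ[ℚ] K, g ^ 2 = 1) (φ₀ : K →+* ℂ)
    (hK : finrank ℚ K = 64) :
    0 < {Φ : CMType K |
      (∀ χ : AddChar (Additive (K ≃ₐ[ℚ] K)) ℂ, χ (Additive.ofMul (conjGal : K ≃ₐ[ℚ] K)) = -1 →
        ∑ s ∈ (Finset.univ.filter fun s : K ≃ₐ[ℚ] K => embOf φ₀ s ∈ Φ.1), χ (Additive.ofMul s) = 0 ∨
          (∑ s ∈ (Finset.univ.filter fun s : K ≃ₐ[ℚ] K => embOf φ₀ s ∈ Φ.1), χ (Additive.ofMul s)) ^ 2 =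
            2 * ((Finset.univ.filter fun s : K ≃ₐ[ℚ] K => embOf φ₀ s ∈ Φ.1).card : ℂ)) ∧
      Nat.card (twistStabilizer Φ) = 1}.ncard := by
  haveI := finite_cmType_pf (K := K)
  obtain ⟨Φ, hnb, h1, -⟩ := exists_nearBent_natCard_twistStabilizer_eq_one_of_finrank_eq_sixtyFour hexp φ₀ hK
  exact (Set.ncard_pos (Set.toFinite _)).2 ⟨Φ, hnb, h1⟩

end Count

end MultiquadraticPrimitiveNearBent

end Literature.AlgebraicGeometry.Pohlmann1968
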